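import Summits.NavierStokesRegularity.NavierStokesRegularity.Theorems.EulerZoomLiouvillePowerGaugeEulerLiouvilleNeedleThinCoreMember

/-!
# (G_F) THE FROBENIUS NEEDLE INPUT — plate t50-G_F of nsreg-p2 ROUND-47 «WHO HOLDS THE RIDGE»
(`r47/Sketch47.lean` sha16 c5b0bf755040b563, text VERBATIM)

Width piece for crux `EulerZoomLiouville.PowerGaugeEulerLiouville` (stmt-NavierStokesRegularity-19832), by name under
LEAD 19832 (ns-typeII-p2 g14) and planner nsreg-p2 g37; seat ns-ezl-w2 g5,
`--supports stmt-NavierStokesRegularity-19832 --as helper`.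

The tree's `NeedleThinCore.selfSimilar_needle_inputs` (2nd conjunct, `…NeedleThinCoreMember`) produces the
OPERATOR-NORM E-weight `∫⁻ ‖fderiv ℝ V y‖ₑ² ‖y‖^{ρ−1} ≤ (1−ρ)/(2+ρ)·c` of a `C¹` exactly self-similar class member.
THEOREM K⁗ charges DISJOINT ENTRIES of `DV` (column / row / block / diagonal, `frobeniusNormSq_eq_sum` in an orthonormal
frame), so it needs the same bound with the FROBENIUS norm kept — which is free, because the E-gauge `cknE` is DEFINED
with `frobeniusNormSq` (`Literature.Analysis.FluidPDE.SuitableWeak`) and `EnergySaturation.profileData_of_selfSimilar`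
already states the profile's weak-gradient weight in Frobenius form; the weak gradient of a `C¹` map is its classical
derivative a.e. (`HasWeakFDerivOn.unique_holds`, `HasWeakFDerivOn.of_contDiff_holds`).

* `selfSimilar_needle_input_frobenius` — the working form;
* `frobeniusNeedleInput` = `NsregP2.R47.FrobeniusNeedleInput` binder-for-binder (`E3` written out).

HONEST FRAMING: bookkeeping on the MODEL lattice of crux E; proves nothing about the crux (19832 OPEN), about
`Sig.stub_selfSimilarC2Needle`, about THEOREM K⁗, or about Navier–Stokes regularity; no hard core is touched. [folklore]
-/

noncomputable section

set_option linter.dupNamespace false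

open MeasureTheory Set Filter Topology Metric Function TopologicalSpace
open scoped ENNReal NNReal

namespace Summit.NavierStokesRegularity.NavierStokesRegularity.Theorems.PowerGaugeEulerLiouville.NeedleThinCore

open Literature.Analysis Literature.Analysis.FluidPDE Literature.Analysis.FunctionSpaces

/-- **(G_F) THE FROBENIUS NEEDLE INPUT**, working form: under the crux hypotheses verbatim (suitable weak Euler
solution on `ℝ³ × (−∞,0)`, weak spatial gradient `H`, power gauges `a^{2ρ}A + a^ρE + a^{2ρ}D ≤ c` for all `a > 0`),
exact self-similarity with `γ = 1/(2+ρ)` and a `C¹` profile `V`, `0 < ρ < 1`: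
`∫⁻ |DV(y)|²_F ‖y‖^{ρ−1} dy ≤ (1−ρ)/(2+ρ)·c` (Frobenius norm; the op-norm version `selfSimilar_needle_inputs` is the
weaker statement). [folklore] -/
theorem selfSimilar_needle_input_frobenius {ρ : ℝ} (hρ : 0 < ρ) (hρ1 : ρ < 1)
    {u : ℝ → EuclideanSpace ℝ (Fin 3) → EuclideanSpace ℝ (Fin 3)} {p : ℝ → EuclideanSpace ℝ (Fin 3) → ℝ}
    {H : ℝ → EuclideanSpace ℝ (Fin 3) → EuclideanSpace ℝ (Fin 3) →L[ℝ] EuclideanSpace ℝ (Fin 3)} {c : ℝ≥0}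
    (hsw : IsSuitableWeakSolutionOn (slab (EuclideanSpace ℝ (Fin 3)) (Iio 0) isOpen_Iio) 0 0 u p)
    (hH : HasWeakSpatialGradientOn (slab (EuclideanSpace ℝ (Fin 3)) (Iio 0) isOpen_Iio) u H)
    (hgauge : ∀ a : ℝ, 0 < a →
      ENNReal.ofReal (a ^ (2 * ρ)) * cknA a (0 : ℝ × EuclideanSpace ℝ (Fin 3)) u +
          ENNReal.ofReal (a ^ ρ) * cknE a (0 : ℝ × EuclideanSpace ℝ (Fin 3)) H +
        ENNReal.ofReal (a ^ (2 * ρ)) * cknD a (0 : ℝ × EuclideanSpace ℝ (Fin 3)) p ≤ (c : ℝ≥0∞))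
    {V : EuclideanSpace ℝ (Fin 3) → EuclideanSpace ℝ (Fin 3)} {P : EuclideanSpace ℝ (Fin 3) → ℝ}
    (hu : ∀ τ : ℝ, τ < 0 → u τ = selfSimilarCollapse (1 / (2 + ρ)) 0 V τ)
    (hp : ∀ τ : ℝ, τ < 0 → p τ = selfSimilarCollapsePressure (1 / (2 + ρ)) 0 P τ)
    (hV : ContDiff ℝ 1 V) :
    ∫⁻ y, ENNReal.ofReal (frobeniusNormSq (fderiv ℝ V y)) * ENNReal.ofReal (‖y‖ ^ (ρ - 1)) ≤
      ENNReal.ofReal ((1 - ρ) / (2 + ρ) * (c : ℝ)) := by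
  obtain ⟨G, -, -, -, -, hVG, -, hE, -⟩ := EnergySaturation.profileData_of_selfSimilar hρ hρ1 hsw hH hgauge hu hp
  -- the weak gradient is the classical one, a.e.
  have hae : G =ᵐ[volume] fderiv ℝ V := by
    have h := HasWeakFDerivOn.unique_holds hVG (HasWeakFDerivOn.of_contDiff_holds ⊤ volume hV)
    rwa [Opens.coe_top, Measure.restrict_univ] at h
  have hcongr : ∫⁻ y, ENNReal.ofReal (frobeniusNormSq (fderiv ℝ V y)) * ENNReal.ofReal (‖y‖ ^ (ρ - 1)) =
      ∫⁻ y, ENNReal.ofReal (frobeniusNormSq (G y)) * ENNReal.ofReal (‖y‖ ^ (ρ - 1)) := by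
    refine lintegral_congr_ae ?_
    filter_upwards [hae] with y hy
    rw [hy]
  have h0 : (0 : ℝ) ≤ (1 - ρ) / (2 + ρ) := by
    have : 0 ≤ 1 - ρ := by linarith
    positivity
  rw [hcongr, ENNReal.ofReal_mul h0, ENNReal.ofReal_coe_nnreal]
  exact hE

/-- **(G_F) `NsregP2.R47.FrobeniusNeedleInput`, binder-for-binder** (Sketch47 of nsreg-p2 g37, plate t50-G_F; `E3`
written out): the 2nd conjunct of `NeedleThinCore.selfSimilar_needle_inputs` with `‖fderiv ℝ V y‖²` replaced by
`frobeniusNormSq (fderiv ℝ V y)` — no loss, since `cknE` is Frobenius by definition. [folklore] -/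
theorem frobeniusNeedleInput :
    ∀ (ρ : ℝ), 0 < ρ → ρ < 1 →
      ∀ (u : ℝ → EuclideanSpace ℝ (Fin 3) → EuclideanSpace ℝ (Fin 3)) (p : ℝ → EuclideanSpace ℝ (Fin 3) → ℝ)
        (H : ℝ → EuclideanSpace ℝ (Fin 3) → EuclideanSpace ℝ (Fin 3) →L[ℝ] EuclideanSpace ℝ (Fin 3)) (c : ℝ≥0),
        IsSuitableWeakSolutionOn (slab (EuclideanSpace ℝ (Fin 3)) (Iio 0) isOpen_Iio) 0 0 u p →
        HasWeakSpatialGradientOn (slab (EuclideanSpace ℝ (Fin 3)) (Iio 0) isOpen_Iio) u H →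
        (∀ a : ℝ, 0 < a →
          ENNReal.ofReal (a ^ (2 * ρ)) * cknA a (0 : ℝ × EuclideanSpace ℝ (Fin 3)) u +
              ENNReal.ofReal (a ^ ρ) * cknE a (0 : ℝ × EuclideanSpace ℝ (Fin 3)) H +
            ENNReal.ofReal (a ^ (2 * ρ)) * cknD a (0 : ℝ × EuclideanSpace ℝ (Fin 3)) p ≤ (c : ℝ≥0∞)) →
        ∀ (V : EuclideanSpace ℝ (Fin 3) → EuclideanSpace ℝ (Fin 3)) (P : EuclideanSpace ℝ (Fin 3) → ℝ),
          (∀ τ : ℝ, τ < 0 → u τ = selfSimilarCollapse (1 / (2 + ρ)) 0 V τ) →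
          (∀ τ : ℝ, τ < 0 → p τ = selfSimilarCollapsePressure (1 / (2 + ρ)) 0 P τ) →
          ContDiff ℝ 1 V →
          ∫⁻ y, ENNReal.ofReal (frobeniusNormSq (fderiv ℝ V y)) * ENNReal.ofReal (‖y‖ ^ (ρ - 1)) ≤
            ENNReal.ofReal ((1 - ρ) / (2 + ρ) * (c : ℝ)) :=
  fun _ hρ hρ1 _ _ _ _ hsw hH hgauge _ _ hu hp hV => selfSimilar_needle_input_frobenius hρ hρ1 hsw hH hgauge hu hp hV

end Summit.NavierStokesRegularity.NavierStokesRegularity.Theorems.PowerGaugeEulerLiouville.NeedleThinCore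

end
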